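import Summits.ResolutionOfSingularities.ResolutionOfSingularities.Theorems.WeightedInvariantKeyRungThreeOfDrop
import HarnessLib

/-!
# hgame for `(ι₃ᵗ, J₃ᵗ)`: the conjunct «`f ∈ 𝔪_Q²` along the canonical centre» DISCHARGED (equimultiplicity along the top `ι₀`-stratum);
# gap list of `stub_keyRungGrHomLE_three` = hD, (weighted presentation + drop at the canonical centre)
# (door `HypersurfaceCentreConstruction`, stmt-ResolutionOfSingularities-19897)

Helper for `stub_keyRungGrHomLE_three` (def-free, `--supports 19897`).  Sequel of …KeyRungThreeOfDrop (gap list hD, hdrop).  Along the top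
`ι₀ = (ν ; ε ; τ)`-stratum `V(P)` the order of `f` is constant (first letter of `ι₀`), so `f ∈ 𝔪_S²` gives `f/1 ∈ 𝔪_{S_Q}²` at every prime
`Q ⊇ P` (`algebraMap_mem_maximalIdeal_sq_of_topStratum`).  Hence **`canonicalGameClauseHomLE_three_of_weightedPresentation`**: hgame
`CanonicalGameClauseHomLE 3 p iotaFlatT jFlatT` ⟸ hpres = «at the canonical centre `P` (prime, `S ⧸ P` regular, `f ∈ P`, `topStratum ι₀ S f = V(P)`)
there is a weighted regular system of parameters `(u, w)` with `span {u_i : w_i > 0} = P`, `weightedMonomialIdeal u w = J₃ᵗ S f`, and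
`WeightedDropHom iotaFlatT S f P u w`», and the GAP LIST OF RECORD **`keyRungGrHomLE_three_of_weightedPresentation`** (hD, hpres).
[OURS · L1 W4.3 · audit glue; AI work, weaker than expert review; nothing here is a statement of the manuscript under review.]
-/

noncomputable section

set_option linter.dupNamespace false -- mandated namespace of this single-conjunct summit

open IsLocalRing Literature.AlgebraicGeometry.Resolution
open Summit.ResolutionOfSingularities.ResolutionOfSingularities.Theorems
open Summit.ResolutionOfSingularities.ResolutionOfSingularities.Theorems.ContactCylinder

namespace Summit.ResolutionOfSingularities.ResolutionOfSingularities.Cruxes.HypersurfaceCentreConstruction.LocalEngine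

namespace Iota3

/-- **Equimultiplicity along the top `ι₀`-stratum, order-`2` form**: if `topStratum ι₀ S f = V(P)`, `f ∈ 𝔪_S²` and `P ≤ Q`, then
`f/1 ∈ 𝔪_{S_Q}²` (the order is the first letter of `ι₀`). [OURS · L1 W4.3] -/
theorem algebraMap_mem_maximalIdeal_sq_of_topStratum (S : Type) [CommRing S] [IsLocalRing S] {f : S}
    (hf2 : f ∈ (maximalIdeal S) ^ 2) {P : Ideal S} (hE : topStratum iotaOrdEpsTau S f = {𝔮 | P ≤ 𝔮.asIdeal})
    (Q : Ideal S) [Q.IsPrime] (hPQ : P ≤ Q) :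
    algebraMap S (Localization.AtPrime Q) f ∈ (maximalIdeal (Localization.AtPrime Q)) ^ 2 := by
  have hmem : (⟨Q, ‹_›⟩ : PrimeSpectrum S) ∈ topStratum iotaOrdEpsTau S f := by rw [hE]; exact hPQ
  have h0 : iotaOrdEpsTau (Localization.AtPrime Q) (algebraMap S (Localization.AtPrime Q) f) = iotaOrdEpsTau S f := hmem
  have hord : iotaOrd (Localization.AtPrime Q) (algebraMap S (Localization.AtPrime Q) f) = iotaOrd S f :=
    ((iotaOrdEps_eq_iff _ _ _ _).mp ((iotaOrdEpsTau_eq_iff _ _ _ _).mp h0).1).1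
  have h2 : ((2 : ℕ) : Ordinal) ≤ iotaOrd S f := (natCast_le_iotaOrd_iff S f 2).mpr hf2
  rw [← hord] at h2
  exact (natCast_le_iotaOrd_iff _ _ 2).mp h2

end Iota3

open Iota3

/-- **hgame ⟸ a WEIGHTED PRESENTATION WITH DROP at the canonical centre.**  `CanonicalGameClauseHomLE 3 p iotaFlatT jFlatT` follows
from: for every `S`, `f` of the clause and every prime `P` with `S ⧸ P` regular, `f ∈ P`, `topStratum ι₀ S f = V(P)`, a weighted regular
system of parameters `(u, w)` with `span {u_i : w_i > 0} = P`, `weightedMonomialIdeal u w m = J₃ᵗ S f m` and `WeightedDropHom iotaFlatT S f P u w`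
(conjuncts (i), (ii) by `exists_canonicalCentre_iotaFlatT`, `f ∈ 𝔪_Q²` along `V(P)` by `algebraMap_mem_maximalIdeal_sq_of_topStratum`).
[OURS · L1 W4.3 · audit glue] -/
theorem canonicalGameClauseHomLE_three_of_weightedPresentation (p : ℕ)
    (hpres : ∀ (k₀ : Type) [Field k₀] [CharP k₀ p] [PerfectField k₀]
      (S : Type) [CommRing S] [Algebra k₀ S] [Algebra.EssFiniteType k₀ S] [IsRegularLocalRing S]
      (f : S), ringKrullDim S ≤ 3 → f ≠ 0 → f ∈ (maximalIdeal S) ^ 2 →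
      ∀ (P : Ideal S) [P.IsPrime], IsRegularLocalRing (S ⧸ P) → f ∈ P →
        topStratum iotaOrdEpsTau S f = {𝔮 | P ≤ 𝔮.asIdeal} →
        ∃ (n : ℕ) (u : Fin n → S) (w : Fin n → ℕ),
          Ideal.span (Set.range u) = maximalIdeal S ∧ (maximalIdeal S).spanFinrank = n ∧ (∃ i, 0 < w i) ∧
          Ideal.span {x | ∃ i, 0 < w i ∧ x = u i} = P ∧
          (∀ m : ℕ, weightedMonomialIdeal u w m = jFlatT S f m) ∧
          WeightedDropHom iotaFlatT S f P u w) :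
    CanonicalGameClauseHomLE 3 p iotaFlatT jFlatT := by
  refine canonicalGameClauseHomLE_three_of_presentation p fun k₀ _ _ _ S _ _ _ _ f hd hf0 hf2 P _ hreg hfP hE => ?_
  obtain ⟨n, u, w, h1, h2, h3, h4, h5, h7⟩ := hpres k₀ S f hd hf0 hf2 P hreg hfP hE
  exact ⟨n, u, w, h1, h2, h3, h4, h5, fun Q _ hPQ => algebraMap_mem_maximalIdeal_sq_of_topStratum S hf2 hE Q hPQ, h7⟩

/-- **GAP LIST OF RECORD for `stub_keyRungGrHomLE_three` — hD, hpres.**  `KeyRungGrHomLE 3 p` from hD (desc-τ as typed; door-proved;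
typing item) and hpres = a weighted regular system of parameters presenting the canonical centre and `J₃ᵗ`, with the `t`-homogeneous
weighted drop of `ι₃ᵗ` — the centre, its `ι₃ᵗ`/`J₃ᵗ`-characterisation, the order condition along it, and LEMMA C′ being discharged.
[OURS · L1 W4.3 · audit glue] -/
theorem keyRungGrHomLE_three_of_weightedPresentation (p : ℕ)
    (hD : ∀ (T T' : Type) [CommRing T] [IsRegularLocalRing T] [CommRing T'] [IsRegularLocalRing T'] [Algebra T T']
      [IsLocalHom (algebraMap T T')] [Algebra.FormallySmooth T T'] [Algebra.EssFiniteType T T'] (g : T),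
      ringKrullDim T' ≤ 3 → IsTiePosition T' (algebraMap T T' g) → IsTiePosition T g)
    (hpres : ∀ (k₀ : Type) [Field k₀] [CharP k₀ p] [PerfectField k₀]
      (S : Type) [CommRing S] [Algebra k₀ S] [Algebra.EssFiniteType k₀ S] [IsRegularLocalRing S]
      (f : S), ringKrullDim S ≤ 3 → f ≠ 0 → f ∈ (maximalIdeal S) ^ 2 →
      ∀ (P : Ideal S) [P.IsPrime], IsRegularLocalRing (S ⧸ P) → f ∈ P →
        topStratum iotaOrdEpsTau S f = {𝔮 | P ≤ 𝔮.asIdeal} →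
        ∃ (n : ℕ) (u : Fin n → S) (w : Fin n → ℕ),
          Ideal.span (Set.range u) = maximalIdeal S ∧ (maximalIdeal S).spanFinrank = n ∧ (∃ i, 0 < w i) ∧
          Ideal.span {x | ∃ i, 0 < w i ∧ x = u i} = P ∧
          (∀ m : ℕ, weightedMonomialIdeal u w m = jFlatT S f m) ∧
          WeightedDropHom iotaFlatT S f P u w) :
    KeyRungGrHomLE 3 p :=
  keyRungGrHomLE_three_of_game p hD (canonicalGameClauseHomLE_three_of_weightedPresentation p hpres)

end Summit.ResolutionOfSingularities.ResolutionOfSingularities.Cruxes.HypersurfaceCentreConstruction.LocalEngine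

end
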